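import Summits.QuantumFields.BalabanUV.T4Continuum.Support.NE7HomogeneousLiftFlat
import Summits.QuantumFields.BalabanUV.T4Continuum.Support.NE7EffectiveFormUpperBound
import HarnessLib

/-!
# NE7EffectiveFormGradientBound — THE SCALE-CORRECT UPPER BOUND OF BAŁABAN'S VARIATIONAL QUADRATIC FORM AT THE FLAT BACKGROUND BY THE COARSE GRADIENT ENERGY:
# `D²(minAct_{j+1} ∘ chart_1)(0)[v,v] ≤ homC 4 · Σ_{x ∈ [0,N)^4} Σ_μ Σ_ν ‖ṽ(x+e_μ)_ν − ṽ(x)_ν‖²_{HS∕n}` — EVERY LEVEL `j`, EVERY VOLUME `N`, EVERY `U(n)`, EVERY `L ≥ 2`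

Lineage `b2b-balaban-t4-ne7b-p1` (row NE7b OWNER; junction service for row NE7), generation 160; item (U) of `t4/b2b-balaban-t4-ne7-p1-g116/ROAD-G116.md` §6, homogeneous half, file 4 (assembly).
§1 (every `d`) THE CORRECTOR FOR ANY `linQ_M`-EXACT LIFT: if `linQ (L^{j+1}) A (L^{j+1}•y) κ = φ y κ` then `R := A + dPot (interp (L^{j+1}) univ (framePot L (j+1) A))` satisfies
`cpushIter L j 1 R = φ` (the proof of row NE3's ✓ `cpushIter_flat_smoothRightInverse` verbatim), is skew∕periodic with `A`, has the curl of `A`, and — by ✓ `NE7SmoothRightInverseLevelQ.coe_levelQ'_flatCfg_resDir`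
— its torus restriction is a `levelQ'`-preimage of `v` when `φ = ṽ`.  §2 (`d = 4`) with `A = hlift (L^{j+1}) ṽ` of ✓ `NE7HomogeneousLiftFlat` (exact, skew, periodic, curl energy `≤ homC d·M^{d−4}·Σ‖∇ṽ‖²`)
and ✓ `NE7MinActHessianFlatCurl.minAct_hessian_flat_curl` (the Hessian is the least curl energy over preimages): **`effectiveForm_le_grad_flat_allLevels`** (the display; `M^{d−4} = 1`).
Together with ✓ `NE7EffectiveFormGaugeFixedCoercive.effectiveForm_ge_grad_landau_flat_allLevels` (the road, gen 116): **`effectiveForm_grad_two_sided_landau_flat_allLevels`** — ON THE COARSE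
LANDAU SLICE `Σ‖∇ṽ‖² ≤ ⟨v, Δ_{j+1} v⟩ ≤ homC 4·Σ‖∇ṽ‖²`: Bałaban's variational `Δ^{flat}_{j+1}` IS UNIFORMLY EQUIVALENT TO THE LATTICE LAPLACIAN ON THE GAUGE-FIXED SUBSPACE, every `j`, `N`, `n`, `L`.
(`homC d = 2·(2304·4^d + 4d·(24·8^{d−1})²·d·2^{4d})`; at `d = 4`: `2·(589 824 + 16·12288²·262 144)`; not optimised.)
HONEST FRAMING: flat datum; quadratic-form bounds for OUR variational `Δ_{j+1}` (B11 (8) minimisers with `sfClass`); nothing of Bałaban's asserted ([Balaban1984PropagatorsI] (1.20)–(1.21)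
context only); NOT NE7 as a spine node; row NE7b NOT touched; spine 0∕9; finite T⁴ rung (B)+1 — NOT infinite volume, NOT mass gap, NOT BetaPertH, NOT Clay.
-/

set_option autoImplicit false

open scoped BigOperators Matrix Matrix.Norms.L2Operator Topology
open NormedSpace Finset

namespace Summit.QuantumFields.BalabanUV.T4Continuum.NE7EffectiveFormGradientBound

open Literature.MathematicalPhysics.QuantumFieldTheory.Balaban1983to89
open B7Prop1Explicit B7Prop2Explicit
open B7Prop3Flat (linQ)
open T4AveragingDeficitWall (curl curlAt IsSkewDir)
open T4AveragingDeficitWallBoundary (periodBox)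
open AveragingDeficitPeriodicCounting (IsPeriodicDir)
open AveragingDeficitTorusChart (TDir chart chartDir resDir isPeriodicDir_chartDir chartDir_id_resDir)
open AveragingDeficitTwoLevelPrep (skewSub skewPF skewPF_of_mem)
open AveragingDeficitMultiLevelPrep (tower levelQ' tower_ne_zero)
open ReplicationRightInverse (cpushIter)
open MinimalActionLevels (perWin stepWt)
open MinimalActionSandwich (minAct)
open MinimalActionRate (sfClass)
open MinimalActionWitness (flatCfg)
open MatrixNorms (nhsNormSq nhsNormSq_nonneg)
open SmoothRefineBlocks (res)
open SmoothRefineNeutral (Tcoarse)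
open SmoothRefineInterp (interp indic interp_mem)
open NE3TangentNoGoWords (dPot)
open NE3TangentFlatPush (flatCfg_eq_flat)
open NE3TangentFlatStructure (Qcoarse framePot iterate_Tcoarse_eq' framePot_add_period dPot_add_period)
open NE3FramePotGauge (iterate_Tcoarse_dPot)
open NE3FrameFreeDecompositionPrep (framePot_mem_skewAdjoint)
open NE3CoarseInterpolant (interp_corner interp_add_period)
open NE3SmoothLiftProfile (lprof)
open NE3SmoothLiftFlat (smoothLift)
open NE3SmoothRightInverseFlat (cpushIter_flat iterate_Tcoarse_add iterate_Qcoarse_apply)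
open NE3SmoothRightInverseCurl (curlAt_flat_add curlAt_flat_dPot)
open NE7MinActHessianFlatCurl (minAct_hessian_flat_curl)
open NE7EffectiveFormCoarseCurlAllLevels (stepWt_four tower_window)
open NE7EffectiveFormGaugeFixedCoercive (effectiveForm_ge_grad_landau_flat_allLevels)
open NE7SmoothRightInverseLevelQ (coe_levelQ'_flatCfg_resDir resDir_chartDir_id)
open NE7FlatAverageCurlCommutation (isSkewDir_chartDir_id)
open NE7HomogeneousLiftFlat (linQ_homogeneousLift isSkewDir_homogeneousLift homogeneousLift_add_period sum_nhsNormSq_curl_homogeneousLift_le)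

noncomputable section

variable {d : ℕ} {n : Type} [Fintype n] [DecidableEq n]

/-! ## §1 The curl-free corrector of any `linQ_M`-exact lift (every `d`) -/

/-- **ANY `linQ_M`-EXACT LIFT PLUS ROW NE3's CORRECTOR IS A RIGHT INVERSE OF THE `(j+1)`-FOLD LINEARISED AVERAGE** (`L ≥ 2`): if `linQ (L^{j+1}) A (L^{j+1}•y) κ = φ y κ` for all `y, κ`
then `cpushIter L j 1 (A + dPot (interp (L^{j+1}) univ (framePot L (j+1) A))) = φ`. [folklore] -/
theorem cpushIter_flat_corrected {L : ℕ} (hL : 2 ≤ L) (j : ℕ) {A φ : Site d → Fin d → Matrix n n ℂ}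
    (hA : ∀ (y : Site d) (κ : Fin d), linQ (L ^ (j + 1)) A (((L ^ (j + 1) : ℕ) : ℤ) • y) κ = φ y κ) :
    cpushIter L j (BlockAveragePushDirSplit.flat (d := d) (n := n)) (A + dPot (interp (L ^ (j + 1)) Finset.univ (framePot L (j + 1) A))) = φ := by
  have hL1 : 1 ≤ L := by omega
  have hM1 : 1 ≤ L ^ (j + 1) := Nat.one_le_pow _ _ hL1
  set G := framePot L (j + 1) A with hG
  rw [cpushIter_flat hL1, iterate_Tcoarse_add, iterate_Tcoarse_eq' hL1 (j + 1) A, iterate_Tcoarse_dPot hL1 (j + 1)]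
  funext z κ
  simp only [Pi.add_apply]
  have hQ : (Qcoarse L)^[j + 1] A z κ = φ z κ := by rw [iterate_Qcoarse_apply, hA]
  have hcorner : (fun w => interp (L ^ (j + 1)) Finset.univ G (((L : ℤ) ^ (j + 1)) • w)) = G := by
    funext w
    have h := interp_corner hM1 Finset.univ G w
    rwa [show (((L ^ (j + 1) : ℕ) : ℤ)) = (L : ℤ) ^ (j + 1) by push_cast; ring] at h
  rw [hQ, hcorner, ← hG, sub_add_cancel]

/-- The corrected lift of a skew `A` is skew. [folklore] -/
theorem isSkewDir_corrected (L j : ℕ) {A : Site d → Fin d → Matrix n n ℂ} (hA : IsSkewDir A) :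
    IsSkewDir (A + dPot (interp (L ^ (j + 1)) Finset.univ (framePot L (j + 1) A))) := by
  intro x κ
  have hI : ∀ y : Site d, interp (L ^ (j + 1)) Finset.univ (framePot L (j + 1) A) y ∈ skewAdjoint (Matrix n n ℂ) :=
    fun y => interp_mem (skewAdjoint (Matrix n n ℂ)) (fun r _ hX => skewAdjoint.smul_mem r hX) _ _ (framePot_mem_skewAdjoint L (j + 1) hA) y
  simp only [Pi.add_apply, dPot]
  exact (skewAdjoint (Matrix n n ℂ)).add_mem (hA x κ) ((skewAdjoint (Matrix n n ℂ)).sub_mem (hI _) (hI _))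

/-- The corrected lift of an `(L^{j+1}·N)`-periodic `A` is `(L·tower L N j)`-periodic (`L ≥ 1`). [folklore] -/
theorem isPeriodicDir_corrected {L : ℕ} (hL : 1 ≤ L) (j : ℕ) {N : ℕ} {A : Site d → Fin d → Matrix n n ℂ}
    (hA : ∀ (x : Site d) (τ κ : Fin d), A (x + ((L ^ (j + 1) * N : ℕ) : ℤ) • e τ) κ = A x κ) :
    IsPeriodicDir (A + dPot (interp (L ^ (j + 1)) Finset.univ (framePot L (j + 1) A))) ((L * tower L N j : ℕ) : ℤ) := by
  have hM1 : 1 ≤ L ^ (j + 1) := Nat.one_le_pow _ _ hL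
  have e1 : L * tower L N j = L ^ (j + 1) * N := by rw [tower_window]; ring
  have hG : ∀ (z : Site d) (τ : Fin d), framePot L (j + 1) A (z + (N : ℤ) • e τ) = framePot L (j + 1) A z :=
    framePot_add_period L (j + 1) A (P := (N : ℤ)) (fun y τ μ => by
      have h := hA y τ μ
      rwa [show (((L ^ (j + 1) * N : ℕ) : ℤ)) = (L : ℤ) ^ (j + 1) * (N : ℤ) by push_cast; ring] at h)
  intro x τ κ
  rw [e1]
  simp only [Pi.add_apply]
  rw [hA x τ κ, dPot_add_period (fun z τ' => interp_add_period hM1 Finset.univ hG z τ') x τ κ]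

/-- The corrected lift has the curl of `A` (the corrector is a coboundary). [folklore] -/
theorem curl_flat_corrected (L j : ℕ) (A : Site d → Fin d → Matrix n n ℂ) (p : T4AveragingDeficitWall.Plaq d) :
    curl (BlockAveragePushDirSplit.flat (d := d) (n := n)) (A + dPot (interp (L ^ (j + 1)) Finset.univ (framePot L (j + 1) A))) p
      = curl (BlockAveragePushDirSplit.flat (d := d) (n := n)) A p := by
  unfold curl
  rw [curlAt_flat_add, curlAt_flat_dPot, add_zero]

/-- **A `linQ_M`-EXACT, SKEW, PERIODIC LIFT OF `ṽ` YIELDS A `levelQ'`-PREIMAGE OF `v` WITH THE SAME CURL** (`L ≥ 2`, every `d`, `j`, `N`, `v ∈ skewSub d n N`). [folklore] -/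
theorem exists_levelQ'_preimage_of_linQ_exact {L N : ℕ} [NeZero L] [NeZero N] (hL : 2 ≤ L) (j : ℕ) (v : ↥(skewSub d n N)) {A : Site d → Fin d → Matrix n n ℂ}
    (hA : ∀ (y : Site d) (κ : Fin d), linQ (L ^ (j + 1)) A (((L ^ (j + 1) : ℕ) : ℤ) • y) κ = chartDir (ContinuousLinearMap.id ℝ (Matrix n n ℂ)) N (v : TDir d n N) y κ)
    (hAs : IsSkewDir A) (hAp : ∀ (x : Site d) (τ κ : Fin d), A (x + ((L ^ (j + 1) * N : ℕ) : ℤ) • e τ) κ = A x κ) :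
    ∃ X : ↥(skewSub d n (L * tower L N j)),
      levelQ' L N j (flatCfg : Site d → Fin d → (Matrix n n ℂ)ˣ) (X : TDir d n (L * tower L N j)) = v ∧
      ∀ p : T4AveragingDeficitWall.Plaq d,
        curl (flatCfg : Site d → Fin d → (Matrix n n ℂ)ˣ) (chartDir (ContinuousLinearMap.id ℝ (Matrix n n ℂ)) (L * tower L N j) (X : TDir d n (L * tower L N j))) p
          = curl (flatCfg : Site d → Fin d → (Matrix n n ℂ)ˣ) A p := by
  have hL1 : 1 ≤ L := by omega
  haveI : NeZero (L * tower L N j) := ⟨Nat.mul_ne_zero (NeZero.ne L) (tower_ne_zero L N j)⟩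
  set R := A + dPot (interp (L ^ (j + 1)) Finset.univ (framePot L (j + 1) A)) with hR
  have hRs : IsSkewDir R := isSkewDir_corrected L j hAs
  have hRp : IsPeriodicDir R ((L * tower L N j : ℕ) : ℤ) := isPeriodicDir_corrected hL1 j hAp
  refine ⟨⟨resDir (L * tower L N j) R, fun r κ => hRs (boxVec (L * tower L N j) r) κ⟩, ?_, fun p => ?_⟩
  · apply Subtype.ext
    rw [coe_levelQ'_flatCfg_resDir j R hRp, flatCfg_eq_flat, hR, cpushIter_flat_corrected hL j hA, resDir_chartDir_id]
    exact skewPF_of_mem v.2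
  · show curl (flatCfg : Site d → Fin d → (Matrix n n ℂ)ˣ) (chartDir (ContinuousLinearMap.id ℝ (Matrix n n ℂ)) (L * tower L N j) (resDir (L * tower L N j) R)) p = _
    rw [chartDir_id_resDir _ hRp, flatCfg_eq_flat, hR, curl_flat_corrected]

/-! ## §2 `d = 4`: the gradient-energy upper bound, and the two-sided estimate on the Landau slice -/

/-- **THE GRADIENT-ENERGY UPPER BOUND** (`d = 4`, every `U(n)`, `L ≥ 2`): for `0 < ε ≤ ε₀`, `N ≥ 1`, EVERY `j`, every `v ∈ skewSub 4 n N`,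
`D²(minAct 4 (sfClass 4 L N ε) L N (j+1) ∘ chart_1)(0)[v, v] ≤ homC 4 · Σ_{x ∈ periodBox N} Σ_μ Σ_ν nhsNormSq (ṽ(x + e_μ) ν − ṽ x ν)`,
`homC 4 = 2·(2304·4⁴ + 16·(24·8³)²·(4·2¹⁶))` — uniformly in `j`, `N`, `n`, `L`; a CONSTANT coarse field has `D²m = 0`. [folklore] -/
theorem effectiveForm_le_grad_flat_allLevels [Nonempty n] {L : ℕ} [NeZero L] (hL : 2 ≤ L) :
    ∃ ε₀ : ℝ, 0 < ε₀ ∧ ∀ ε : ℝ, 0 < ε → ε ≤ ε₀ → ∀ (N : ℕ) [NeZero N], 1 ≤ N → ∀ (j : ℕ) (v : ↥(skewSub 4 n N)),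
      fderiv ℝ (fderiv ℝ (fun y : ↥(skewSub 4 n N) => minAct 4 (sfClass 4 L N ε) L N (j + 1)
          (chart (ContinuousLinearMap.id ℝ (Matrix n n ℂ)) N (flatCfg : Site 4 → Fin 4 → (Matrix n n ℂ)ˣ) (y : TDir 4 n N)))) 0 v v
        ≤ 2 * (2304 * 4 ^ 4 + 4 * (4 : ℝ) * (24 * (8 : ℝ) ^ 3) ^ 2 * ((4 : ℝ) * 2 ^ 16))
          * ∑ x ∈ periodBox N, ∑ μ : Fin 4, ∑ ν : Fin 4,
              nhsNormSq (chartDir (ContinuousLinearMap.id ℝ (Matrix n n ℂ)) N (v : TDir 4 n N) (x + e μ) ν - chartDir (ContinuousLinearMap.id ℝ (Matrix n n ℂ)) N (v : TDir 4 n N) x ν) := by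
  obtain ⟨ε₀, hε₀, H⟩ := minAct_hessian_flat_curl (n := n) hL
  refine ⟨ε₀, hε₀, fun ε hε hεle N _ hN j v => ?_⟩
  obtain ⟨-, hleast⟩ := H ε hε hεle N hN j
  have hL1 : 1 ≤ L := by omega
  set M : ℕ := L ^ (j + 1) with hMdef
  have hM2 : 2 ≤ M := by
    calc 2 ≤ L := hL
      _ = L ^ 1 := (pow_one L).symm
      _ ≤ L ^ (j + 1) := Nat.pow_le_pow_right (by omega) (by omega)
  have hM1 : 1 ≤ M := by omega
  set φ := chartDir (ContinuousLinearMap.id ℝ (Matrix n n ℂ)) N (v : TDir 4 n N) with hφ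
  have hφp : ∀ (z : Site 4) (τ κ : Fin 4), φ (z + (N : ℤ) • e τ) κ = φ z κ := fun z τ κ => isPeriodicDir_chartDir _ N (v : TDir 4 n N) z τ κ
  -- the homogeneous lift at scale `M = L^{j+1}`
  set A : Site 4 → Fin 4 → Matrix n n ℂ :=
    (fun z κ' => ((12 * (M : ℝ) / ((((M : ℝ)) - 1) * ((M : ℝ) + 1) * ((M : ℝ) + 2))) * lprof M (res M z κ'))
        • interp M (Finset.univ.erase κ') (fun w => φ w κ') z)
      + smoothLift M (fun y' κ'' => φ y' κ'' - ∑ T ∈ (Finset.univ.erase κ'').powerset,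
          ((((M : ℝ)) ^ (4 - 1))⁻¹ * ((((M : ℝ)) - 1) / 2) ^ T.card * ((((M : ℝ)) + 1) / 2) ^ ((4 - 1) - T.card)) • φ (y' + indic T) κ'') with hAdef
  have hAexact : ∀ (y : Site 4) (κ : Fin 4), linQ M A ((M : ℤ) • y) κ = φ y κ := fun y κ => linQ_homogeneousLift hM2 φ y κ
  have hAexact' : ∀ (y : Site 4) (κ : Fin 4), linQ (L ^ (j + 1)) A (((L ^ (j + 1) : ℕ) : ℤ) • y) κ = φ y κ := hAexact
  have hAs : IsSkewDir A := isSkewDir_homogeneousLift M (isSkewDir_chartDir_id v.2)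
  have hAp : ∀ (x : Site 4) (τ κ : Fin 4), A (x + ((L ^ (j + 1) * N : ℕ) : ℤ) • e τ) κ = A x κ := fun x τ κ => homogeneousLift_add_period hM1 hφp x τ κ
  obtain ⟨X, hXv, hXcurl⟩ := exists_levelQ'_preimage_of_linQ_exact hL j v hAexact' hAs hAp
  -- the Hessian is below the curl energy of the preimage
  have hle := (hleast v).2 ⟨X, hXv, rfl⟩
  rw [stepWt_four, inv_one, one_pow, one_mul, Finset.sum_congr rfl fun p _ => by rw [hXcurl p]] at hle
  refine hle.trans ?_
  have henergy := sum_nhsNormSq_curl_homogeneousLift_le (n := n) hM2 (by norm_num : 1 ≤ 4) hN hφp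
  rw [show M * N = N * L ^ (j + 1) from by rw [hMdef, Nat.mul_comm], ← flatCfg_eq_flat] at henergy
  have hM0 : (M : ℝ) ≠ 0 := by exact_mod_cast (by omega : M ≠ 0)
  rw [div_self (pow_ne_zero _ hM0), mul_one] at henergy
  refine henergy.trans (le_of_eq ?_)
  norm_num

/-- **THE TWO-SIDED GRADIENT ESTIMATE ON THE COARSE LANDAU SLICE** (`d = 4`): for `ṽ` coarse-Landau (`Σ_μ (ṽ(x)_μ − ṽ(x−e_μ)_μ) = 0`),
`Σ_x Σ_μ Σ_ν nhsNormSq (∇_μ ṽ_ν (x)) ≤ D²m_{j+1}(0)[v,v] ≤ homC 4·Σ_x Σ_μ Σ_ν nhsNormSq (∇_μ ṽ_ν (x))` — `Δ^{flat}_{j+1}` is uniformly equivalent to the lattice Laplacian on the gauge-fixed subspace,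
every `j`, `N`, `n`, `L` (floor: the road's ✓ `effectiveForm_ge_grad_landau_flat_allLevels`; one `ε₀`). [folklore] -/
theorem effectiveForm_grad_two_sided_landau_flat_allLevels [Nonempty n] {L : ℕ} [NeZero L] (hL : 2 ≤ L) :
    ∃ ε₀ : ℝ, 0 < ε₀ ∧ ∀ ε : ℝ, 0 < ε → ε ≤ ε₀ → ∀ (N : ℕ) [NeZero N], 1 ≤ N → ∀ (j : ℕ) (v : ↥(skewSub 4 n N)),
      (∀ x : Site 4, ∑ μ : Fin 4,
          (chartDir (ContinuousLinearMap.id ℝ (Matrix n n ℂ)) N (v : TDir 4 n N) x μ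
            - chartDir (ContinuousLinearMap.id ℝ (Matrix n n ℂ)) N (v : TDir 4 n N) (x - e μ) μ) = 0) →
      ∑ x ∈ periodBox N, ∑ μ : Fin 4, ∑ ν : Fin 4,
          nhsNormSq (chartDir (ContinuousLinearMap.id ℝ (Matrix n n ℂ)) N (v : TDir 4 n N) (x + e μ) ν - chartDir (ContinuousLinearMap.id ℝ (Matrix n n ℂ)) N (v : TDir 4 n N) x ν)
          ≤ fderiv ℝ (fderiv ℝ (fun y : ↥(skewSub 4 n N) => minAct 4 (sfClass 4 L N ε) L N (j + 1)
              (chart (ContinuousLinearMap.id ℝ (Matrix n n ℂ)) N (flatCfg : Site 4 → Fin 4 → (Matrix n n ℂ)ˣ) (y : TDir 4 n N)))) 0 v v ∧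
      fderiv ℝ (fderiv ℝ (fun y : ↥(skewSub 4 n N) => minAct 4 (sfClass 4 L N ε) L N (j + 1)
          (chart (ContinuousLinearMap.id ℝ (Matrix n n ℂ)) N (flatCfg : Site 4 → Fin 4 → (Matrix n n ℂ)ˣ) (y : TDir 4 n N)))) 0 v v
        ≤ 2 * (2304 * 4 ^ 4 + 4 * (4 : ℝ) * (24 * (8 : ℝ) ^ 3) ^ 2 * ((4 : ℝ) * 2 ^ 16))
          * ∑ x ∈ periodBox N, ∑ μ : Fin 4, ∑ ν : Fin 4,
              nhsNormSq (chartDir (ContinuousLinearMap.id ℝ (Matrix n n ℂ)) N (v : TDir 4 n N) (x + e μ) ν - chartDir (ContinuousLinearMap.id ℝ (Matrix n n ℂ)) N (v : TDir 4 n N) x ν) := by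
  obtain ⟨ε₁, hε₁, H₁⟩ := effectiveForm_ge_grad_landau_flat_allLevels (n := n) hL
  obtain ⟨ε₂, hε₂, H₂⟩ := effectiveForm_le_grad_flat_allLevels (n := n) hL
  refine ⟨min ε₁ ε₂, lt_min hε₁ hε₂, fun ε hε hεle N _ hN j v hdiv => ⟨?_, ?_⟩⟩
  · exact H₁ ε hε (hεle.trans (min_le_left _ _)) N hN j v hdiv
  · exact H₂ ε hε (hεle.trans (min_le_right _ _)) N hN j v

end

end Summit.QuantumFields.BalabanUV.T4Continuum.NE7EffectiveFormGradientBound
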